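import Mathlib
import Literature.NumberTheory.LFunctions.WeilWindowSimpleEven
import Literature.NumberTheory.LFunctions.WeilExplicitProofs

/-!
# Stub `stub_multipliers` of line `Sketch` for crux `SignCone.SignConeDuality`
(item stmt-RiemannHypothesis-16304, route route-RiemannHypothesis-SignCone)

The instantiation of the cone-multiplier engine on the IMAGE CONE of the Weil cone `P(a)`:
given the engine, a Slater bump, far-node vanishing, additivity and homogeneity of the prime-free
Weil form `W_ar := weilPolarTerm + weilArchTerm` (all hypotheses of the stub, supplied by the
other stubs of the line), the unit-slack sign-cone inequality at cutoff `a` yields nonnegative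
node multipliers `l n` (`2 ≤ n < ⌈e^{2a}⌉`) with `∑ l n · Re G(log n) ≤ Re W_ar(G) + Re G(0)` for
every Weil test `g` supported in `[-a, a]`, `G = g ⋆ g̃`.

Proof. Let `ι := {n // n ∈ Finset.Ico 2 ⌈e^{2a}⌉₊}` (the active nodes: `log n < 2a`) and
`S ⊆ ℝ × ℝ^ι` the set of moment vectors `(Re W_ar(F) + Re F(0), (Re F(log n))_{n ∈ ι})` of the
autocorrelation sums `F = ∑ i, g i ⋆ (g i)̃` of admissible finite families. `S` is closed under `+`
(append the families: `F` adds, `W_ar` is additive on test kernels) and under positive scaling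
(replace `g i` by `√r · g i`: `F ↦ r F`, `W_ar ↦ r W_ar`); the sign-cone inequality gives
`x.2 ≥ 0 ⇒ x.1 ≥ 0` on `S` because the inactive nodes `n ≥ ⌈e^{2a}⌉` (`log n ≥ 2a`) carry
`F(log n) = 0`; the Slater bump is a point of `S` with all node coordinates positive. The engine
returns `l ≥ 0` on `ι` with `∑ l · x.2 ≤ x.1` on `S`; evaluate at the family `(1, g)`.
-/

noncomputable section

open scoped BigOperators ComplexConjugate
open Complex MeasureTheory Set

namespace Summit.RiemannHypothesis.RiemannHypothesis.Theorems.SignConeDuality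

open Literature.NumberTheory.LFunctions

/-! ### Families of autocorrelations -/

/-- The autocorrelation `g ⋆ g̃` of a Weil test is a Weil test. -/
theorem isWeilTest_autocorr {g : ℝ → ℂ} (hg : IsWeilTest g) :
    IsWeilTest (weilConv g (weilReflect g)) :=
  hg.weilConv hg.weilReflect

/-- A finite sum of Weil tests (as a function of `t`) is a Weil test. -/
theorem isWeilTest_fun_sum {k : ℕ} (G : Fin k → ℝ → ℂ) (hG : ∀ i, IsWeilTest (G i)) :
    IsWeilTest (fun t => ∑ i, G i t) := by
  have h : (fun t => ∑ i, G i t) = ∑ i, G i := by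
    funext t
    simp [Finset.sum_apply]
  rw [h]
  exact Finset.sum_induction _ (fun F : ℝ → ℂ => IsWeilTest F) (fun _ _ ha hb => ha.add hb)
    (⟨contDiff_zero_fun, HasCompactSupport.zero⟩ : IsWeilTest (0 : ℝ → ℂ)) (fun i _ => hG i)

/-- The autocorrelation sum of an appended family is the sum of the two autocorrelation sums. -/
theorem autocorrSum_append {k₁ k₂ : ℕ} (g₁ : Fin k₁ → ℝ → ℂ) (g₂ : Fin k₂ → ℝ → ℂ) (t : ℝ) :
    ∑ i, weilConv (Fin.append g₁ g₂ i) (weilReflect (Fin.append g₁ g₂ i)) t =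
      ∑ i, weilConv (g₁ i) (weilReflect (g₁ i)) t +
        ∑ i, weilConv (g₂ i) (weilReflect (g₂ i)) t := by
  rw [Fin.sum_univ_add]
  simp only [Fin.append_left, Fin.append_right]

/-- Scaling a test by a constant `c` scales its autocorrelation by `c · conj c`. -/
theorem autocorr_const_mul (c : ℂ) (g : ℝ → ℂ) :
    weilConv (fun t => c * g t) (weilReflect (fun t => c * g t)) =
      fun t => (c * conj c) * weilConv g (weilReflect g) t := by
  rw [weilReflect_const_mul, weilConv_const_mul_left, weilConv_const_mul_right]
  funext t
  ring

/-- For real `r ≥ 0`, `√r · conj √r = r` in `ℂ`. -/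
theorem sqrt_mul_conj_sqrt {r : ℝ} (hr : 0 ≤ r) :
    ((Real.sqrt r : ℂ)) * conj ((Real.sqrt r : ℂ)) = (r : ℂ) := by
  rw [Complex.conj_ofReal, ← Complex.ofReal_mul, Real.mul_self_sqrt hr]

/-- The autocorrelation sum of the family `√r · g i` is `r` times that of `g`. -/
theorem autocorrSum_sqrt_mul {k : ℕ} (g : Fin k → ℝ → ℂ) {r : ℝ} (hr : 0 ≤ r) (t : ℝ) :
    ∑ i, weilConv (fun s => (Real.sqrt r : ℂ) * g i s)
        (weilReflect (fun s => (Real.sqrt r : ℂ) * g i s)) t =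
      (r : ℂ) * ∑ i, weilConv (g i) (weilReflect (g i)) t := by
  rw [Finset.mul_sum]
  refine Finset.sum_congr rfl fun i _ => ?_
  rw [autocorr_const_mul, sqrt_mul_conj_sqrt hr]

/-- Scaling preserves admissibility at cutoff `a`. -/
theorem admissible_const_mul {a : ℝ} (c : ℂ) {g : ℝ → ℂ}
    (hg : IsWeilTest g ∧ tsupport g ⊆ Set.Icc (-a) a) :
    IsWeilTest (fun t => c * g t) ∧ tsupport (fun t => c * g t) ⊆ Set.Icc (-a) a :=
  ⟨hg.1.const_mul c,
    (tsupport_mul_subset_right (f := fun _ : ℝ => c) (g := g)).trans hg.2⟩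

/-- Nodes beyond the cutoff: for `n ≥ ⌈e^{2a}⌉₊` (and `n ≥ 1`) one has `2a ≤ log n`. -/
theorem two_mul_le_log_of_ceil_le {a : ℝ} {n : ℕ} (hn1 : 1 ≤ n)
    (hn : ⌈Real.exp (2 * a)⌉₊ ≤ n) : 2 * a ≤ Real.log n := by
  have h1 : Real.exp (2 * a) ≤ n := (Nat.le_ceil _).trans (by exact_mod_cast hn)
  have hpos : (0 : ℝ) < n := by exact_mod_cast hn1
  rw [Real.le_log_iff_exp_le hpos]
  exact h1

/-- Active nodes: for `1 ≤ n < ⌈e^{2a}⌉₊` one has `log n < 2a`. -/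
theorem log_lt_two_mul_of_lt_ceil {a : ℝ} {n : ℕ} (hn1 : 1 ≤ n)
    (hn : n < ⌈Real.exp (2 * a)⌉₊) : Real.log n < 2 * a := by
  have h1 : (n : ℝ) < Real.exp (2 * a) := Nat.lt_ceil.mp hn
  have hpos : (0 : ℝ) < n := by exact_mod_cast hn1
  rw [Real.log_lt_iff_lt_exp hpos]
  exact h1

/-! ### The stub -/

/-- **Stub `stub_multipliers`** (line `Sketch`, crux `SignCone.SignConeDuality`): from the
cone-multiplier engine, the Slater bump, far-node vanishing, additivity and homogeneity of the
prime-free Weil form, the unit-slack sign-cone inequality at cutoff `a` yields nonnegative node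
multipliers `l` with `∑_{2 ≤ n < ⌈e^{2a}⌉} l n · Re G(log n) ≤ Re W_ar(G) + Re G(0)` for every Weil
test `g` supported in `[-a, a]` (`G = g ⋆ g̃`). The engine is applied to the image of the Weil cone
under the moment map `F ↦ (Re W_ar(F) + Re F(0), (Re F(log n))_{2 ≤ n < ⌈e^{2a}⌉})`. -/
theorem stub_multipliers :
    (∀ (ι : Type) [Fintype ι] (S : Set (ℝ × (ι → ℝ))),
      (∀ x ∈ S, ∀ y ∈ S, x + y ∈ S) →
      (∀ r : ℝ, 0 < r → ∀ x ∈ S, r • x ∈ S) →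
      (∀ x ∈ S, (∀ i, 0 ≤ x.2 i) → 0 ≤ x.1) →
      (∃ x ∈ S, ∀ i, 0 < x.2 i) →
      ∃ l : ι → ℝ, (∀ i, 0 ≤ l i) ∧ ∀ x ∈ S, ∑ i, l i * x.2 i ≤ x.1) →
    (∀ a : ℝ, 0 < a →
      ∃ g : ℝ → ℂ, IsWeilTest g ∧ tsupport g ⊆ Set.Icc (-a) a ∧
        ∀ n : ℕ, 2 ≤ n → Real.log n < 2 * a →
          0 < (weilConv g (weilReflect g) (Real.log n)).re) →
    (∀ (a : ℝ) (g : ℝ → ℂ), IsWeilTest g → tsupport g ⊆ Set.Icc (-a) a →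
      ∀ t : ℝ, 2 * a ≤ t → weilConv g (weilReflect g) t = 0) →
    (∀ F₁ F₂ : ℝ → ℂ, IsWeilTest F₁ → IsWeilTest F₂ →
      weilPolarTerm (F₁ + F₂) + weilArchTerm (F₁ + F₂) =
        (weilPolarTerm F₁ + weilArchTerm F₁) + (weilPolarTerm F₂ + weilArchTerm F₂)) →
    (∀ (c : ℂ) (F : ℝ → ℂ),
      weilPolarTerm (fun t => c * F t) + weilArchTerm (fun t => c * F t) =
        c * (weilPolarTerm F + weilArchTerm F)) →
    ∀ a : ℝ, 0 < a →
      (∀ (k : ℕ) (g : Fin k → ℝ → ℂ),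
          (∀ i, IsWeilTest (g i) ∧ tsupport (g i) ⊆ Set.Icc (-a) a) →
          (∀ n : ℕ, 2 ≤ n → 0 ≤ (∑ i, weilConv (g i) (weilReflect (g i)) (Real.log n)).re) →
          -(∑ i, weilConv (g i) (weilReflect (g i)) 0).re ≤
            (weilPolarTerm (fun t => ∑ i, weilConv (g i) (weilReflect (g i)) t) +
              weilArchTerm (fun t => ∑ i, weilConv (g i) (weilReflect (g i)) t)).re) →
      ∃ l : ℕ → ℝ, (∀ n, 0 ≤ l n) ∧
        ∀ g : ℝ → ℂ, IsWeilTest g → tsupport g ⊆ Set.Icc (-a) a →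
          ∑ n ∈ Finset.Ico 2 ⌈Real.exp (2 * a)⌉₊,
              l n * (weilConv g (weilReflect g) (Real.log n)).re ≤
            (weilPolarTerm (weilConv g (weilReflect g)) +
                weilArchTerm (weilConv g (weilReflect g))).re +
              (weilConv g (weilReflect g) 0).re := by
  intro hE hSl hFar hAdd hSc a ha hX
  classical
  -- cf. Cruxes/SignConeDuality/CandidateIdeator2.lean (crux-ideate r1 k2) for the same bookkeeping
  set N : ℕ := ⌈Real.exp (2 * a)⌉₊ with hN
  -- admissible tests, the Weil cone `K`, the objective `L₀`, the moment map `m`, the image `S`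
  let adm : (ℝ → ℂ) → Prop := fun g => IsWeilTest g ∧ tsupport g ⊆ Set.Icc (-a) a
  let K : Set (ℝ → ℂ) :=
    {F | ∃ (k : ℕ) (g : Fin k → ℝ → ℂ), (∀ i, adm (g i)) ∧
      F = fun t => ∑ i, weilConv (g i) (weilReflect (g i)) t}
  let L₀ : (ℝ → ℂ) → ℝ := fun F => (weilPolarTerm F + weilArchTerm F).re + (F 0).re
  let m : (ℝ → ℂ) → ℝ × ({n // n ∈ Finset.Ico 2 N} → ℝ) :=
    fun F => (L₀ F, fun n => (F (Real.log (n : ℕ))).re)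
  let S : Set (ℝ × ({n // n ∈ Finset.Ico 2 N} → ℝ)) := m '' K
  -- (K1) members of `K` are test kernels
  have hKtest : ∀ F ∈ K, IsWeilTest F := by
    rintro F ⟨k, g, hg, rfl⟩
    exact isWeilTest_fun_sum _ (fun i => isWeilTest_autocorr (hg i).1)
  -- (K2) `K` is closed under addition: append the families
  have hKadd : ∀ F ∈ K, ∀ F' ∈ K, F + F' ∈ K := by
    rintro F ⟨k, g, hg, rfl⟩ F' ⟨k', g', hg', rfl⟩
    refine ⟨k + k', Fin.append g g', fun i => ?_, ?_⟩
    · refine Fin.addCases (fun i => ?_) (fun i => ?_) i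
      · rw [Fin.append_left]
        exact hg i
      · rw [Fin.append_right]
        exact hg' i
    · funext t
      simp only [Pi.add_apply]
      exact (autocorrSum_append g g' t).symm
  -- (K3) `K` is closed under positive scaling: rescale the family by `√r`
  have hKsmul : ∀ r : ℝ, 0 < r → ∀ F ∈ K, (fun t => (r : ℂ) * F t) ∈ K := by
    rintro r hr F ⟨k, g, hg, rfl⟩
    refine ⟨k, fun i s => (Real.sqrt r : ℂ) * g i s, fun i => admissible_const_mul _ (hg i), ?_⟩
    funext t
    exact (autocorrSum_sqrt_mul g hr.le t).symm
  -- (L) additivity and homogeneity of the objective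
  have h₀add : ∀ F ∈ K, ∀ F' ∈ K, L₀ (F + F') = L₀ F + L₀ F' := by
    intro F hF F' hF'
    simp only [L₀]
    rw [hAdd F F' (hKtest F hF) (hKtest F' hF')]
    simp only [Pi.add_apply, Complex.add_re]
    ring
  have h₀smul : ∀ (r : ℝ) (F : ℝ → ℂ), L₀ (fun t => (r : ℂ) * F t) = r * L₀ F := by
    intro r F
    simp only [L₀]
    rw [hSc (r : ℂ) F]
    simp only [Complex.re_ofReal_mul]
    ring
  -- the four hypotheses of the engine on the image cone `S`
  have hSadd : ∀ x ∈ S, ∀ y ∈ S, x + y ∈ S := by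
    rintro x ⟨F, hF, rfl⟩ y ⟨F', hF', rfl⟩
    refine ⟨F + F', hKadd F hF F' hF', ?_⟩
    refine Prod.ext ?_ (funext fun n => ?_)
    · simp only [m, Prod.fst_add]
      exact h₀add F hF F' hF'
    · simp only [m, Prod.snd_add, Pi.add_apply, Complex.add_re]
  have hSsmul : ∀ r : ℝ, 0 < r → ∀ x ∈ S, r • x ∈ S := by
    rintro r hr x ⟨F, hF, rfl⟩
    refine ⟨fun t => (r : ℂ) * F t, hKsmul r hr F hF, ?_⟩
    refine Prod.ext ?_ (funext fun n => ?_)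
    · simp only [m, Prod.smul_fst, smul_eq_mul]
      exact h₀smul r F
    · simp only [m, Prod.smul_snd, Pi.smul_apply, smul_eq_mul, Complex.re_ofReal_mul]
  have hSpos : ∀ x ∈ S, (∀ i, 0 ≤ x.2 i) → 0 ≤ x.1 := by
    rintro x ⟨F, ⟨k, g, hg, rfl⟩, rfl⟩ hnodes
    have hall : ∀ n : ℕ, 2 ≤ n →
        0 ≤ (∑ i, weilConv (g i) (weilReflect (g i)) (Real.log n)).re := by
      intro n hn
      by_cases hlt : n < N
      · have h := hnodes ⟨n, Finset.mem_Ico.2 ⟨hn, hlt⟩⟩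
        simpa [m] using h
      · push Not at hlt
        have hlog : 2 * a ≤ Real.log n := two_mul_le_log_of_ceil_le (by omega) hlt
        rw [Finset.sum_eq_zero fun i _ => hFar a (g i) (hg i).1 (hg i).2 _ hlog]
        simp
    have h := hX k g hg hall
    simp only [m, L₀]
    linarith
  have hSsl : ∃ x ∈ S, ∀ i, 0 < x.2 i := by
    obtain ⟨g₀, hg₀, hg₀supp, hg₀pos⟩ := hSl a ha
    refine ⟨m (fun t => ∑ i : Fin 1, weilConv g₀ (weilReflect g₀) t),
      ⟨_, ⟨1, fun _ => g₀, fun _ => ⟨hg₀, hg₀supp⟩, rfl⟩, rfl⟩, ?_⟩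
    rintro ⟨n, hn⟩
    obtain ⟨hn2, hnN⟩ := Finset.mem_Ico.1 hn
    simp only [m, Fin.sum_univ_one]
    exact hg₀pos n hn2 (log_lt_two_mul_of_lt_ceil (by omega) hnN)
  -- the engine
  obtain ⟨l, hl0, hl⟩ := hE _ S hSadd hSsmul hSpos hSsl
  refine ⟨fun n => if h : n ∈ Finset.Ico 2 N then l ⟨n, h⟩ else 0, fun n => ?_, ?_⟩
  · by_cases h : n ∈ Finset.Ico 2 N
    · simp only [h, dif_pos]
      exact hl0 _
    · simp [h]
  · intro g hg hsupp
    have hGK : (fun t => ∑ i : Fin 1, weilConv g (weilReflect g) t) ∈ K :=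
      ⟨1, fun _ => g, fun _ => ⟨hg, hsupp⟩, rfl⟩
    have hmain := hl _ ⟨_, hGK, rfl⟩
    have hG1 : (fun t => ∑ i : Fin 1, weilConv g (weilReflect g) t) =
        weilConv g (weilReflect g) := by
      funext t
      simp
    rw [hG1] at hmain
    simp only [m, L₀] at hmain
    have hsum : ∑ n ∈ Finset.Ico 2 N, (if h : n ∈ Finset.Ico 2 N then l ⟨n, h⟩ else 0) *
          (weilConv g (weilReflect g) (Real.log n)).re =
        ∑ i : {n // n ∈ Finset.Ico 2 N}, l i * (weilConv g (weilReflect g) (Real.log (i : ℕ))).re := by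
      rw [← Finset.sum_coe_sort (Finset.Ico 2 N)]
      refine Finset.sum_congr rfl fun i _ => ?_
      rw [dif_pos i.2]
    rw [hsum]
    exact hmain

end Summit.RiemannHypothesis.RiemannHypothesis.Theorems.SignConeDuality

end
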